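import Summits.QuantumFields.QCD.Theses.PauliWegnerSea

/-!
# `GluonicCompletion` (crux stmt-QuantumFields-9152), line `certified-sea-threshold-graft` — a certified mutation
of the registered stub `stub_cutoffWindow`

refuter-drefute-stmt-QuantumFields-9152-0 (drefute), 2026-08-16. The lead's reshaped `stub_cutoffWindow` derives
the cutoff window ("every bare Wilson mass of an `H`-trajectory is eventually below every `ε > 0`") from clause
(iii) of the crux's hypothesis ALONE. This file certifies that the positivity `0 < c₀` of the lower bound's
amplitude is load-bearing: with `0 ≤ c₀` the clause is vacuous at `c₀ = 0` (the phase-quenched fractional-moment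
quotient is `≥ 0`) and the lattice-massive regularisation `canonicalAF` with `m_crit ≡ 5` is admitted, whose
bare masses never enter `(-1, 1)`. Any proof of the stub must use `0 < c₀`.
-/

namespace Summit.QuantumFields.QCD.Theorems.GluonicCompletion.Negative

open MeasureTheory Filter Literature.MathematicalPhysics.QuantumFieldTheory
  Literature.MathematicalPhysics.QuantumLattice Literature.Probability.LatticeModels

/-- **`stub_cutoffWindow` is false without `0 < c₀`** (supports stmt-QuantumFields-9152; line
`certified-sea-threshold-graft`): the registered stub with `0 < c₀` weakened to `0 ≤ c₀`, otherwise verbatim,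
is refuted by `N_f = 1`, `reg := canonicalAF 1` with `m_crit ≡ 5`, `m = 1`, `ε = 1` — the weakened clause
(iii) holds with `c₀ = 0` since the quotient of the two Wilson-measure integrals is non-negative, while
`5 + a_k/Z_m(k) > 1` for every `k`. [folklore] -/
theorem cutoffWindow_false_without_pos_amplitude :
    ¬ (∀ (Nf : ℕ) (reg : QCDRegularisation Nf),
        (∀ m : Fin Nf → ℝ, (∀ f, 0 < m f) → ∃ s c₀ C₁ p : ℝ, 0 < s ∧ s < 1 ∧ 0 ≤ c₀ ∧ ∀ᶠ k in atTop, ∀ S : ℕ, reg.L k ≤ S → ∀ (f : Fin Nf) (n : ℕ), n ≤ S → c₀ * Real.exp (-(C₁ * (reg.a k * n) + p * Real.log (n + 1))) ≤ (∫ U : GaugeConfig 4 (2 * S + 1) (Matrix.specialUnitaryGroup (Fin 3) ℂ), ‖(diracMatrix U fun fl => reg.mcrit k + reg.a k * m fl / reg.Zm k).det‖ * (∑ a : Fin 3, ∑ i : Fin 4, ∑ b : Fin 3, ∑ j : Fin 4, ‖(diracMatrix U fun fl => reg.mcrit k + reg.a k * m fl / reg.Zm k)⁻¹ (quarkEquiv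 (f, (Torus.proj (2 * S + 1) 0, a, i))) (quarkEquiv (f, (Torus.proj (2 * S + 1) (Pi.single 0 (n : ℤ)), b, j)))‖) ^ s ∂(wilsonMeasure (fundamentalRep (Fin 3)) (reg.β k))) / (∫ U : GaugeConfig 4 (2 * S + 1) (Matrix.specialUnitaryGroup (Fin 3) ℂ), ‖(diracMatrix U fun fl => reg.mcrit k + reg.a k * m fl / reg.Zm k).det‖ ∂(wilsonMeasure (fundamentalRep (Fin 3)) (reg.β k)))) →
          ∀ m : Fin Nf → ℝ, (∀ f, 0 < m f) → ∀ (f : Fin Nf) (ε : ℝ), 0 < ε →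
            ∀ᶠ k in atTop, reg.mcrit k + reg.a k * m f / reg.Zm k < ε) := by
  intro h
  let reg : QCDRegularisation 1 := { QCDRegularisation.canonicalAF 1 with mcrit := fun _ => 5 }
  have hyp : ∀ m : Fin 1 → ℝ, (∀ f, 0 < m f) → ∃ s c₀ C₁ p : ℝ, 0 < s ∧ s < 1 ∧ 0 ≤ c₀ ∧
      ∀ᶠ k in atTop, ∀ S : ℕ, reg.L k ≤ S → ∀ (f : Fin 1) (n : ℕ), n ≤ S →
        c₀ * Real.exp (-(C₁ * (reg.a k * n) + p * Real.log (n + 1))) ≤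
          (∫ U : GaugeConfig 4 (2 * S + 1) (Matrix.specialUnitaryGroup (Fin 3) ℂ),
              ‖(diracMatrix U fun fl => reg.mcrit k + reg.a k * m fl / reg.Zm k).det‖ *
                (∑ a : Fin 3, ∑ i : Fin 4, ∑ b : Fin 3, ∑ j : Fin 4,
                  ‖(diracMatrix U fun fl => reg.mcrit k + reg.a k * m fl / reg.Zm k)⁻¹
                      (quarkEquiv (f, (Torus.proj (2 * S + 1) 0, a, i)))
                      (quarkEquiv (f, (Torus.proj (2 * S + 1) (Pi.single 0 (n : ℤ)), b, j)))‖) ^ s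
              ∂(wilsonMeasure (fundamentalRep (Fin 3)) (reg.β k))) /
            (∫ U : GaugeConfig 4 (2 * S + 1) (Matrix.specialUnitaryGroup (Fin 3) ℂ),
              ‖(diracMatrix U fun fl => reg.mcrit k + reg.a k * m fl / reg.Zm k).det‖
              ∂(wilsonMeasure (fundamentalRep (Fin 3)) (reg.β k))) := by
    intro m _
    refine ⟨1 / 2, 0, 0, 0, by norm_num, by norm_num, le_rfl, Eventually.of_forall fun k S _ f n _ => ?_⟩
    rw [zero_mul]
    positivity
  have hev := h 1 reg hyp (fun _ => 1) (fun _ => one_pos) 0 1 one_pos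
  obtain ⟨k, hk⟩ := hev.exists
  have ha : 0 < reg.a k * (1 : ℝ) / reg.Zm k := div_pos (by simpa using reg.a_pos k) (reg.Zm_pos k)
  have h5 : reg.mcrit k = 5 := rfl
  rw [h5] at hk
  linarith

end Summit.QuantumFields.QCD.Theorems.GluonicCompletion.Negative
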